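import Literature.AlgebraicGeometry.Motives.MorphismsToProjectiveSpace
import Mathlib.AlgebraicGeometry.Morphisms.Affine
import Mathlib.AlgebraicGeometry.Morphisms.FiniteType
import Mathlib.AlgebraicGeometry.Morphisms.Proper
import Mathlib.AlgebraicGeometry.ZariskisMainTheorem
import HarnessLib

/-!
# A proper scheme with generating sections whose non-vanishing loci are affine is projective

Let `k` be a field and `Z` a proper `k`-scheme carrying generating-sections data
`D : Literature.GeneratingSections ι Z` (`Motives/MorphismsToProjectiveSpace`: an open cover
`U i = Z_{sᵢ}` and the ratios `s_j/s_i ∈ Γ(Z, U i)` of a family of generating sections `sᵢ` of an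
invertible sheaf `𝓛`) with `ι` finite and **every `U i` affine**. The main theorem of this file,
`Literature.AlgebraicGeometry.Motives.GeneratingSections.isProjectiveOver_of_isAffineOpen`, is that `Z` is then projective over
`k` (`Literature.IsProjectiveOver Z`: a closed `k`-immersion into some `ℙⁿ_k`).

In terms of line bundles this is the conjunction of three printed results: an invertible sheaf
generated by finitely many global sections `sᵢ` with `Z_{sᵢ}` affine is ample (Görtz–Wedhorn I,
Prop. 13.47, (iv) ⇒ (i), p. 493) — equivalently, the morphism `r : Z → ℙ(ι)` defined by the `sᵢ`
is affine, so `𝓛 = r^*𝒪(1)` is ample (Görtz–Wedhorn I, Thm. 13.84, p. 516) —, and a proper scheme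
over a field with an ample line bundle is projective (Görtz–Wedhorn I, Cor. 13.72 with
Summary 13.71 (3), p. 512). Mathlib has no invertible sheaves, so the proof is carried out in
chart form, following the printed proofs (Görtz–Wedhorn I, proof of Prop. 13.47 (iv) ⇒ (i) and of
Thm. 13.59; Hartshorne II, proofs of Lemma 5.14 and Thm. 7.6):

* `GeneratingSections.Sec D d`: global sections of `𝓛^{⊗d}` in chart form — functions
  `t/s_i^d ∈ Γ(Z, U i)` with the transition rule `t/s_j^d = (t/s_i^d)(s_i/s_j)^d`; the sections
  `s_l^{⊗d}` (`Sec.pow`) and products (`Sec.mul`).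
* `GeneratingSections.exists_sec_val_eq` — **extension of sections** (Görtz–Wedhorn I,
  Thm. 7.22 (2), p. 230; Hartshorne II Lemma 5.14 (b)): if `ι` is finite and the `U i` are affine,
  every `b ∈ Γ(Z, U i)` is the `U i`-value of a global section of some `𝓛^{⊗d}` (i.e.
  `b ⊗ s_i^{⊗d}` extends), because `U j ∩ U i = (U j)_{s_i/s_j}` is a basic open of the affine
  `U j`, so `Γ(U j ∩ U i) = Γ(U j)[(s_i/s_j)⁻¹]` (Mathlib `IsAffineOpen.isLocalization_basicOpen`).
* `GeneratingSections.ofSections`: the generating-sections data (of `𝓛^{⊗e}`) defined by a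
  family of sections of `𝓛^{⊗e}` without common zero, each supported in a chosen "home chart".
* `GeneratingSections.embData`: for `k`-algebra generators `g` of the finitely generated
  `k`-algebras `Γ(Z, U i)` (`Z` is locally of finite type), the sections `s_i^{⊗2N}` and
  `g̃ ⊗ s_i^{⊗N}` of `𝓛^{⊗2N}` (`g̃` an extension of `g ⊗ s_i^{⊗N}`); all their non-vanishing loci
  are affine, and at the charts of the `s_i^{⊗2N}` the chart ring maps are surjective
  (`closure_embData_none`).
* `GeneratingSections.isClosedImmersion_of_restrict`: a morphism with closed image which is a
  closed immersion over opens of the target whose preimages cover the source is a closed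
  immersion.
* `GeneratingSections.isProjectiveOver_of_isAffineOpen`: the morphism `Z → ℙᴹ_k` defined by
  `embData` (Hartshorne II Thm. 7.1, `GeneratingSections.toProj`) is a closed immersion over the
  charts `D₊(x_{(i, none)})` (Hartshorne II Prop. 7.2, `isClosedImmersion_toProj_restrict`), which
  cover its image, and its image is closed since `Z` is proper and `ℙᴹ_k` separated over `k`.
* `GeneratingSections.ofHom r`: conversely, the generating-sections data (`r⁻¹ D₊(xᵢ)`,
  `r^*(x_j/x_i)`) of any morphism `r : Y → ℙ(ι)_k` (Hartshorne II Thm. 7.1 (a)); hence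
  (`Literature.AlgebraicGeometry.Motives.isProjectiveOver_of_isAffineHom`, `_of_isFinite`, `_of_locallyQuasiFinite`) a proper
  `k`-scheme admitting an affine, finite or quasi-finite `k`-morphism to some `ℙⁿ_k` is
  projective — Görtz–Wedhorn I, Thm. 13.84 with Cor. 13.72, in which the ampleness of `r^*𝒪(1)`
  is replaced by its consequence; the quasi-finite case uses Zariski's Main Theorem from Mathlib
  (`IsFinite.of_isProper_of_locallyQuasiFinite`; Görtz–Wedhorn I, Cor. 12.89).

This is the last, line-bundle-free step of the printed proofs that abelian varieties are
projective (Görtz–Wedhorn II, Prop. 27.174; Mumford, *Abelian Varieties* §6, Application 1): there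
one produces, by the theorem of the square, finitely many sections of `𝒪(2D)` without common
zero whose non-vanishing loci are affine (intersections of two translates of an affine open).

## References

* U. Görtz, T. Wedhorn, *Algebraic Geometry I: Schemes*, 2nd ed., Springer Spektrum (2020),
  doi:10.1007/978-3-658-30733-2: Thm. 7.22, p. 230 (extension of sections over `X_s`);
  Def. 13.44 and Prop. 13.47, pp. 492–494 (ample line bundles; (iv) finitely many sections with
  affine `X_{fᵢ}` covering `X`); Cor. 12.89, p. 454 (finite = proper + quasi-finite);
  Summary 13.71 and Cor. 13.72, pp. 511–513; Thm. 13.84, p. 516. [GortzWedhorn2020]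
* R. Hartshorne, *Algebraic Geometry*, GTM 52, Springer (1977): II Lemma 5.14, II Thm. 7.1,
  II Prop. 7.2, II Thm. 7.6. [Hartshorne1977]
* U. Görtz, T. Wedhorn, *Algebraic Geometry II*, Springer Spektrum (2023): Prop. 27.174 and
  Lemma 27.175, pp. 880–881. [GortzWedhorn2023]
-/

universe u

open CategoryTheory AlgebraicGeometry Limits HomogeneousLocalization TopologicalSpace Opposite
open MvPolynomial (X C eval₂Hom)
open Literature.AlgebraicGeometry.Motives.Segre

attribute [local instance] MvPolynomial.gradedAlgebra

noncomputable section

namespace Literature.AlgebraicGeometry.Motives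

namespace GeneratingSections

variable {ι : Type} {Y : Scheme.{u}} (D : GeneratingSections ι Y)

/-! ### Restriction maps -/

section Restriction

omit D

/-- Restriction of sections of `𝒪_Y` along `W ≤ U'`, as a ring homomorphism. [folklore] -/
abbrev rs {U' W : Y.Opens} (h : W ≤ U') : Γ(Y, U') →+* Γ(Y, W) :=
  (Y.presheaf.map (homOfLE h).op).hom

/-- Restricting twice is restricting once. [folklore] -/
@[simp]
theorem rs_rs {U' V' W : Y.Opens} (h₁ : V' ≤ U') (h₂ : W ≤ V') (s : Γ(Y, U')) :
    rs h₂ (rs h₁ s) = rs (h₂.trans h₁) s := by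
  change (Y.presheaf.map (homOfLE h₁).op ≫ Y.presheaf.map (homOfLE h₂).op).hom s = _
  rw [← Functor.map_comp, ← op_comp, homOfLE_comp]

/-- Restricting along `le_rfl` is the identity. [folklore] -/
@[simp]
theorem rs_refl {U' : Y.Opens} (s : Γ(Y, U')) : rs (le_refl U') s = s := by
  have h : Y.presheaf.map (homOfLE (le_refl U')).op = 𝟙 _ := by
    rw [show (homOfLE (le_refl U')).op = 𝟙 (op U') from rfl]
    exact Y.presheaf.map_id _
  simp only [rs, h, CommRingCat.hom_id, RingHom.id_apply]

/-- Restriction maps with the same source and target agree (proof irrelevance made explicit for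
rewriting under binders). [folklore] -/
theorem rs_congr {U' W : Y.Opens} (h h' : W ≤ U') (s : Γ(Y, U')) : rs h s = rs h' s := rfl

/-- Restriction along an equality of opens is injective. [folklore] -/
theorem rs_injective_of_eq {U' W : Y.Opens} (e : W = U') :
    Function.Injective (rs (le_of_eq e) : Γ(Y, U') →+* Γ(Y, W)) := by
  subst e
  intro a b h
  simpa using h

/-- The basic open of a restricted section. [folklore] -/
theorem basicOpen_rs {U' W : Y.Opens} (h : W ≤ U') (s : Γ(Y, U')) :
    Y.basicOpen (rs h s) = W ⊓ Y.basicOpen s :=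
  Y.basicOpen_res s (homOfLE h).op

/-- A section is a unit on its basic open (Mathlib `isUnit_res_basicOpen`). [folklore] -/
theorem isUnit_rs_basicOpen {U' : Y.Opens} (s : Γ(Y, U')) :
    IsUnit (rs (Y.basicOpen_le s) s) :=
  Y.toRingedSpace.isUnit_res_basicOpen s

/-- More generally a section is a unit on any open inside its basic open. [folklore] -/
theorem isUnit_rs_of_le_basicOpen {U' W : Y.Opens} (s : Γ(Y, U')) (hW : W ≤ Y.basicOpen s) :
    IsUnit (rs (hW.trans (Y.basicOpen_le s)) s) := by
  rw [← rs_rs (Y.basicOpen_le s) hW]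
  exact (isUnit_rs_basicOpen s).map _

/-- Mathlib's algebra structure `Γ(Y, U') → Γ(Y, Y_s)` is restriction. [folklore] -/
theorem algebraMap_basicOpen_eq_rs {U' : Y.Opens} (s : Γ(Y, U')) :
    algebraMap Γ(Y, U') Γ(Y, Y.basicOpen s) = rs (Y.basicOpen_le s) := rfl

end Restriction

/-! ### The overlaps `V i j = Y_{s_j/s_i} = U i ∩ U j` -/

section Overlap

/-- The overlap `V i j := Y_{ratio i j}`, i.e. `U i ∩ U j` presented as a basic open of `U i`.
[folklore] -/
abbrev V (i j : ι) : Y.Opens := Y.basicOpen (D.ratio i j)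

/-- `V i j = U i ∩ U j`. [folklore] -/
theorem V_eq (i j : ι) : D.V i j = D.U i ⊓ D.U j := D.basicOpen_ratio i j

/-- `V i j ≤ U i`. [folklore] -/
theorem V_le_left (i j : ι) : D.V i j ≤ D.U i := Y.basicOpen_le _

/-- `V i j ≤ U j`. [folklore] -/
theorem V_le_right (i j : ι) : D.V i j ≤ D.U j := by
  rw [V_eq]
  exact inf_le_right

/-- `V i j = V j i` as opens. [folklore] -/
theorem V_comm (i j : ι) : D.V i j = D.V j i := by
  rw [V_eq, V_eq, inf_comm]

/-- `V i i = U i`. [folklore] -/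
theorem V_self (i : ι) : D.V i i = D.U i := by
  rw [V_eq, inf_idem]

/-- The cocycle rule on `V i j`: `(s_j/s_i)(s_l/s_j) = s_l/s_i`. [folklore] -/
theorem cocycle (i j l : ι) :
    rs (D.V_le_left i j) (D.ratio i j) * rs (D.V_le_right i j) (D.ratio j l) =
      rs (D.V_le_left i j) (D.ratio i l) := by
  have h := congrArg (rs (le_of_eq (D.V_eq i j))) (D.ratio_mul_ratio i j l)
  simp only [map_mul, rs_rs] at h
  exact h

/-- `s_j/s_i` is a unit on `V i j`. [folklore] -/
theorem isUnit_ratio_left (i j : ι) : IsUnit (rs (D.V_le_left i j) (D.ratio i j)) :=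
  isUnit_rs_basicOpen _

/-- `(s_j/s_i)(s_i/s_j) = 1` on `V i j`. [folklore] -/
theorem ratio_mul_ratio_symm (i j : ι) :
    rs (D.V_le_left i j) (D.ratio i j) * rs (D.V_le_right i j) (D.ratio j i) = 1 := by
  rw [D.cocycle i j i, D.ratio_self, map_one]

/-- `s_i/s_j` is a unit on `V i j`. [folklore] -/
theorem isUnit_ratio_right (i j : ι) : IsUnit (rs (D.V_le_right i j) (D.ratio j i)) :=
  IsUnit.of_mul_eq_one_right _ (D.ratio_mul_ratio_symm i j)

/-- The cocycle rule solved for `s_l/s_j`: `s_l/s_j = (s_i/s_j)(s_l/s_i)` on `V i j`. [folklore] -/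
theorem ratio_right_eq (i j l : ι) :
    rs (D.V_le_right i j) (D.ratio j l) =
      rs (D.V_le_right i j) (D.ratio j i) * rs (D.V_le_left i j) (D.ratio i l) := by
  have h1 := D.cocycle i j l
  have h2 := D.ratio_mul_ratio_symm i j
  calc rs (D.V_le_right i j) (D.ratio j l)
      = (rs (D.V_le_left i j) (D.ratio i j) * rs (D.V_le_right i j) (D.ratio j i)) *
          rs (D.V_le_right i j) (D.ratio j l) := by rw [h2, one_mul]
    _ = rs (D.V_le_right i j) (D.ratio j i) * rs (D.V_le_left i j) (D.ratio i l) := by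
          rw [← h1]; ring

end Overlap

/-! ### Sections of the tensor powers `𝓛^{⊗d}` in chart form -/

section Sec

/-- **A global section of `𝓛^{⊗d}` in chart form**: regular functions `val i ∈ Γ(Y, U i)`
("`t / s_i^d`") with `val j = val i · (s_i/s_j)^d` on `U i ∩ U j`. For the invertible sheaf `𝓛`
glued from the cocycle of ratios (Görtz–Wedhorn I, Prop. 11.15), these are exactly the global
sections of `𝓛^{⊗d}`, `t ↦ (t/s_i^{⊗d})_i` (Hartshorne II, proof of Thm. 7.6; Görtz–Wedhorn I,
proof of Prop. 13.47 (iv) ⇒ (i)). [folklore] -/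
structure Sec (d : ℕ) where
  /-- The function `t / s_i^d` on `U i`. -/
  val : (i : ι) → Γ(Y, D.U i)
  /-- Transition rule `t/s_j^d = (t/s_i^d) · (s_i/s_j)^d` on `U i ∩ U j`. -/
  compat : ∀ i j, rs (D.V_le_right i j) (val j) =
    rs (D.V_le_left i j) (val i) * rs (D.V_le_right i j) (D.ratio j i) ^ d

namespace Sec

variable {D} {d e : ℕ}

/-- Sections with the same chart values are equal. [folklore] -/
@[ext]
theorem ext {t t' : D.Sec d} (h : ∀ i, t.val i = t'.val i) : t = t' := by
  cases t; cases t'; congr; funext i; exact h i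

/-- The transition rule read on `V j i` instead of `V i j`. [folklore] -/
theorem compat' (t : D.Sec d) (i j : ι) :
    rs (D.V_le_left j i) (t.val j) =
      rs (D.V_le_right j i) (t.val i) * rs (D.V_le_left j i) (D.ratio j i) ^ d := by
  have h := congrArg (rs (le_of_eq (D.V_comm j i))) (t.compat i j)
  simp only [map_mul, map_pow, rs_rs] at h
  exact h

variable (D) in
/-- The section `s_l^{⊗d}`: its `i`-th chart value is `(s_l/s_i)^d`. [folklore] -/
def pow (l : ι) (d : ℕ) : D.Sec d where
  val i := D.ratio i l ^ d
  compat i j := by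
    rw [map_pow, map_pow, ← mul_pow, D.ratio_right_eq i j l, mul_comm]

/-- The chart values of `s_l^{⊗d}`. [folklore] -/
@[simp] theorem pow_val (l : ι) (d : ℕ) (i : ι) : (pow D l d).val i = D.ratio i l ^ d := rfl

/-- The product of sections of `𝓛^{⊗d}` and `𝓛^{⊗e}` (a section of `𝓛^{⊗(d+e)}`). [folklore] -/
def mul (t : D.Sec d) (t' : D.Sec e) : D.Sec (d + e) where
  val i := t.val i * t'.val i
  compat i j := by
    rw [map_mul, map_mul, t.compat, t'.compat, pow_add]
    ring

/-- The chart values of a product of sections. [folklore] -/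
@[simp] theorem mul_val (t : D.Sec d) (t' : D.Sec e) (i : ι) :
    (t.mul t').val i = t.val i * t'.val i := rfl

/-- Transport of a section along an equality of degrees. [folklore] -/
def cast (h : d = e) (t : D.Sec d) : D.Sec e where
  val := t.val
  compat i j := by subst h; exact t.compat i j

/-- The chart values of a transported section. [folklore] -/
@[simp] theorem cast_val (h : d = e) (t : D.Sec d) (i : ι) : (t.cast h).val i = t.val i := rfl

/-- On the home chart `l`, `s_l^{⊗d}` has value `1`. [folklore] -/
theorem pow_val_self (l : ι) (d : ℕ) : (pow D l d).val l = 1 := by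
  rw [pow_val, D.ratio_self, one_pow]

/-- The non-vanishing loci of the chart values of a section agree on overlaps:
`Y_{val i} ∩ U j = Y_{val j} ∩ U i` (both are `Y_t ∩ U i ∩ U j`). [folklore] -/
theorem basicOpen_val_inf (t : D.Sec d) (i j : ι) :
    Y.basicOpen (t.val i) ⊓ D.U j = Y.basicOpen (t.val j) ⊓ D.U i := by
  have hu : IsUnit (rs (D.V_le_right i j) (D.ratio j i) ^ d) := (D.isUnit_ratio_right i j).pow d
  have key : Y.basicOpen (rs (D.V_le_right i j) (t.val j)) =
      Y.basicOpen (rs (D.V_le_left i j) (t.val i)) := by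
    rw [t.compat i j, Y.basicOpen_mul, Y.basicOpen_of_isUnit hu]
    exact inf_eq_left.mpr (Y.basicOpen_le _)
  rw [basicOpen_rs, basicOpen_rs, D.V_eq] at key
  -- key : (U i ⊓ U j) ⊓ Y_{val j} = (U i ⊓ U j) ⊓ Y_{val i}
  have hi : Y.basicOpen (t.val i) ≤ D.U i := Y.basicOpen_le _
  have hj : Y.basicOpen (t.val j) ≤ D.U j := Y.basicOpen_le _
  apply le_antisymm
  · have h : Y.basicOpen (t.val i) ⊓ D.U j ≤ D.U i ⊓ D.U j ⊓ Y.basicOpen (t.val i) :=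
      le_inf (le_inf (inf_le_left.trans hi) inf_le_right) inf_le_left
    rw [← key] at h
    exact le_inf (h.trans inf_le_right) (h.trans (inf_le_left.trans inf_le_left))
  · have h : Y.basicOpen (t.val j) ⊓ D.U i ≤ D.U i ⊓ D.U j ⊓ Y.basicOpen (t.val j) :=
      le_inf (le_inf inf_le_right (inf_le_left.trans hj)) inf_le_left
    rw [key] at h
    exact le_inf (h.trans inf_le_right) (h.trans (inf_le_left.trans inf_le_right))

end Sec

end Sec

/-! ### Extension of sections (Hartshorne II.5.14 / Görtz–Wedhorn I Thm. 7.22 in chart form) -/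

section Extend

variable [Finite ι] (hU : ∀ i, IsAffineOpen (D.U i))
include hU

/-- Step 1 of the extension lemma: for `b ∈ Γ(Y, U i)` there are `N` and `c_j ∈ Γ(Y, U j)` with
`c_j = b · (s_i/s_j)^N` on `U i ∩ U j` for all `j` (because `U j ∩ U i = (U j)_{s_i/s_j}` is a
basic open of the affine `U j`, so `Γ(U j ∩ U i) = Γ(U j)[(s_i/s_j)⁻¹]`). [folklore] -/
theorem exists_local_extensions (i : ι) (b : Γ(Y, D.U i)) :
    ∃ (N : ℕ) (c : (j : ι) → Γ(Y, D.U j)), ∀ j,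
      rs (D.V_le_left j i) (c j) =
        rs (D.V_le_right j i) b * rs (D.V_le_left j i) (D.ratio j i) ^ N := by
  -- chartwise, by the localization property of basic opens of affine opens
  have H : ∀ j, ∃ (n : ℕ) (c : Γ(Y, D.U j)), rs (D.V_le_left j i) c =
      rs (D.V_le_right j i) b * rs (D.V_le_left j i) (D.ratio j i) ^ n := by
    intro j
    haveI := (hU j).isLocalization_basicOpen (D.ratio j i)
    obtain ⟨⟨c, ⟨_, n, rfl⟩⟩, hc⟩ :=
      IsLocalization.surj (Submonoid.powers (D.ratio j i)) (rs (D.V_le_right j i) b)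
    refine ⟨n, c, ?_⟩
    simp only [algebraMap_basicOpen_eq_rs, map_pow] at hc
    exact hc.symm
  choose n c hc using H
  -- uniform exponent
  obtain ⟨N, hN⟩ : ∃ N, ∀ j, n j ≤ N := by
    haveI := Fintype.ofFinite ι
    exact ⟨Finset.univ.sup n, fun j ↦ Finset.le_sup (Finset.mem_univ j)⟩
  refine ⟨N, fun j ↦ c j * D.ratio j i ^ (N - n j), fun j ↦ ?_⟩
  rw [map_mul, map_pow, hc j, mul_assoc, ← pow_add, Nat.add_sub_cancel' (hN j)]

/-- **Extension lemma** (Hartshorne II Lemma 5.14 (b) / Görtz–Wedhorn I Thm. 7.22, for the line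
bundle `𝓛` in chart form): if `ι` is finite and all `U i = Y_{sᵢ}` are affine, then for every
`b ∈ Γ(U i, 𝒪)` there is `d` and a global section `t` of `𝓛^{⊗d}` with `t/s_i^d = b` on `U i`,
i.e. `b ⊗ s_i^{⊗d}` extends to all of `Y`. [folklore] -/
theorem exists_sec_val_eq (i : ι) (b : Γ(Y, D.U i)) :
    ∃ (d : ℕ) (t : D.Sec d), t.val i = b := by
  classical
  obtain ⟨N, c, hc⟩ := D.exists_local_extensions hU i b
  /- Step 2: on `V j j'` the defect `δ = c_{j'} - c_j (s_j/s_{j'})^N` vanishes on the basic open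
    of `s_i/s_j`, hence is killed by a power of `s_i/s_j` (affineness of `V j j'`). -/
  have H : ∀ j j', ∃ e : ℕ, rs (D.V_le_left j j') (D.ratio j i) ^ e *
      (rs (D.V_le_right j j') (c j') -
        rs (D.V_le_left j j') (c j) * rs (D.V_le_right j j') (D.ratio j' j) ^ N) = 0 := by
    intro j j'
    set r := rs (D.V_le_left j j') (D.ratio j i) with hr
    set δ := rs (D.V_le_right j j') (c j') -
        rs (D.V_le_left j j') (c j) * rs (D.V_le_right j j') (D.ratio j' j) ^ N with hδ
    haveI := ((hU j).basicOpen (D.ratio j j')).isLocalization_basicOpen r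
    suffices h0 : algebraMap Γ(Y, D.V j j') Γ(Y, Y.basicOpen r) δ = 0 by
      obtain ⟨⟨_, e, rfl⟩, he⟩ := (IsLocalization.map_eq_zero_iff (Submonoid.powers r) _ δ).mp h0
      exact ⟨e, he⟩
    -- the open `W = (V j j')_r ⊆ U j ∩ U j' ∩ U i`
    have hWV : Y.basicOpen r ≤ D.V j j' := Y.basicOpen_le r
    have hWi : Y.basicOpen r ≤ D.V j i := by
      rw [hr, basicOpen_rs]; exact inf_le_right
    have hWi' : Y.basicOpen r ≤ D.V j' i := by
      rw [D.V_eq j' i]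
      refine le_inf (hWV.trans (D.V_le_right j j')) (hWi.trans (D.V_le_right j i))
    rw [algebraMap_basicOpen_eq_rs, hδ, map_sub, map_mul, map_pow, rs_rs, rs_rs, rs_rs]
    -- express `c j`, `c j'` through `b` on `W`
    have ej := congrArg (rs hWi) (hc j)
    have ej' := congrArg (rs hWi') (hc j')
    simp only [map_mul, map_pow, rs_rs] at ej ej'
    -- the cocycle `(s_j/s_{j'}) (s_i/s_j) = s_i/s_{j'}` on `W`
    have hW' : Y.basicOpen r ≤ D.V j' j := hWV.trans (le_of_eq (D.V_comm j j'))
    have ec := congrArg (rs hW') (D.cocycle j' j i)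
    simp only [map_mul, rs_rs] at ec
    rw [ej', ej, ← ec]
    ring
  choose e he using H
  obtain ⟨E, hE⟩ : ∃ E, ∀ j j', e j j' ≤ E := by
    haveI := Fintype.ofFinite ι
    exact ⟨Finset.univ.sup fun p : ι × ι ↦ e p.1 p.2,
      fun j j' ↦ Finset.le_sup (f := fun p : ι × ι ↦ e p.1 p.2) (Finset.mem_univ (j, j'))⟩
  -- Step 3: the corrected family `c_j (s_i/s_j)^E` is a section of `𝓛^{⊗(N+E)}`
  let t : D.Sec (N + E) :=
    { val := fun j ↦ c j * D.ratio j i ^ E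
      compat := fun j j' ↦ by
        -- goal on `V j j'`: `c_{j'} r_{j'i}^E = c_j r_{ji}^E · r_{j'j}^{N+E}`
        have key := he j j'
        have hsplit : rs (D.V_le_right j j') (D.ratio j' i) =
            rs (D.V_le_right j j') (D.ratio j' j) * rs (D.V_le_left j j') (D.ratio j i) :=
          D.ratio_right_eq j j' i
        rw [map_mul, map_pow, map_mul, map_pow, hsplit, pow_add]
        have hEe : E = e j j' + (E - e j j') := (Nat.add_sub_cancel' (hE j j')).symm
        rw [hEe, pow_add, pow_add]
        set r := rs (D.V_le_left j j') (D.ratio j i)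
        set u := rs (D.V_le_right j j') (D.ratio j' j)
        -- key : r ^ e * (c' - c * u ^ N) = 0
        linear_combination (u ^ (e j j') * u ^ (E - e j j') * r ^ (E - e j j')) * key }
  refine ⟨N + E, t, ?_⟩
  -- on the home chart: `c_i (s_i/s_i)^E = c_i = b`, by injectivity of `Γ(U i) → Γ(V i i)`
  change c i * D.ratio i i ^ E = b
  rw [D.ratio_self, one_pow, mul_one]
  have h := hc i
  rw [D.ratio_self, map_one, one_pow, mul_one] at h
  exact rs_injective_of_eq (D.V_self i) h

end Extend

end GeneratingSections

end Literature.AlgebraicGeometry.Motives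


namespace Literature.AlgebraicGeometry.Motives

namespace GeneratingSections

variable {ι : Type} {Y : Scheme.{u}} (D : GeneratingSections ι Y)

/-! ### Reindexing -/

section Reindex

/-- Reindex generating-sections data along an equivalence of index types. [folklore] -/
def reindex {ι' : Type} (e : ι' ≃ ι) : GeneratingSections ι' Y where
  U a := D.U (e a)
  iSup_U := by rw [Equiv.iSup_comp (g := D.U) e]; exact D.iSup_U
  ratio a b := D.ratio (e a) (e b)
  ratio_self a := D.ratio_self (e a)
  basicOpen_ratio a b := D.basicOpen_ratio (e a) (e b)
  ratio_mul_ratio a b c := D.ratio_mul_ratio (e a) (e b) (e c)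

/-- The opens of reindexed data. [folklore] -/
@[simp] theorem reindex_U {ι' : Type} (e : ι' ≃ ι) (a : ι') : (D.reindex e).U a = D.U (e a) :=
  rfl

/-- The ratios of reindexed data. [folklore] -/
@[simp] theorem reindex_ratio {ι' : Type} (e : ι' ≃ ι) (a b : ι') :
    (D.reindex e).ratio a b = D.ratio (e a) (e b) := rfl

end Reindex

/-! ### New generating-sections data from sections of `𝓛^{⊗e}` -/

section OfSections

variable {M : Type} {e : ℕ} (h : M → ι) (σ : M → D.Sec e)
  (home : ∀ m j, Y.basicOpen ((σ m).val j) ≤ D.U (h m))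
  (cov : ⨆ m, Y.basicOpen ((σ m).val (h m)) = ⊤)

/-- The home-chart value `(σ m)/s_{h m}^e ∈ Γ(Y, U (h m))` of the section `σ m`. [folklore] -/
abbrev num (m : M) : Γ(Y, D.U (h m)) := (σ m).val (h m)

/-- The non-vanishing locus `Y_{σ m}` of the section `σ m`; by the hypothesis `home` it lies in
the home chart `U (h m)`, where it is the basic open of `num m`. [folklore] -/
abbrev U' (m : M) : Y.Opens := Y.basicOpen (D.num h σ m)

/-- `Y_{σ m} ≤ U (h m)`. [folklore] -/
theorem U'_le (m : M) : D.U' h σ m ≤ D.U (h m) := Y.basicOpen_le _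

/-- `σ m / s_{h m}^e` is a unit on `Y_{σ m}`. [folklore] -/
theorem isUnit_num (m : M) : IsUnit (rs (D.U'_le h σ m) (D.num h σ m)) :=
  isUnit_rs_basicOpen _

/-- The ratio `σ m' / σ m` as a regular function on `Y_{σ m}`: computed in the home chart `h m`
as `(σ m'/s^e) · (σ m/s^e)⁻¹`. [folklore] -/
def ratio' (m m' : M) : Γ(Y, D.U' h σ m) :=
  rs (D.U'_le h σ m) ((σ m').val (h m)) * ↑(D.isUnit_num h σ m).unit⁻¹

/-- `ratio' m m' · (σ m / s^e) = σ m' / s^e` on `Y_{σ m}`. [folklore] -/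
theorem ratio'_mul_num (m m' : M) :
    D.ratio' h σ m m' * rs (D.U'_le h σ m) (D.num h σ m) =
      rs (D.U'_le h σ m) ((σ m').val (h m)) := by
  rw [ratio', mul_assoc, IsUnit.val_inv_mul, mul_one]

/-- `σ m / σ m = 1`. [folklore] -/
theorem ratio'_self (m : M) : D.ratio' h σ m m = 1 := by
  rw [ratio']
  exact (D.isUnit_num h σ m).mul_val_inv

include home in
/-- In the home chart of `m`, the non-vanishing locus of `σ m'` is `Y_{σ m} ∩ Y_{σ m'}`:
`Y_{σ m} ∩ Y_{(σ m')/s_{h m}^e} = Y_{σ m} ∩ Y_{σ m'}`. [folklore] -/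
theorem U'_inf_basicOpen (m m' : M) :
    D.U' h σ m ⊓ Y.basicOpen ((σ m').val (h m)) = D.U' h σ m ⊓ D.U' h σ m' := by
  have h1 : Y.basicOpen ((σ m').val (h m)) = Y.basicOpen ((σ m').val (h m)) ⊓ D.U (h m') :=
    (inf_eq_left.mpr (home m' (h m))).symm
  have h2 := (σ m').basicOpen_val_inf (h m) (h m')
  rw [h1, h2, ← inf_assoc, inf_right_comm, inf_eq_left.mpr (D.U'_le h σ m)]

include home in
/-- `Y_{ratio' m m'} = Y_{σ m} ∩ Y_{σ m'}`. [folklore] -/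
theorem basicOpen_ratio' (m m' : M) :
    Y.basicOpen (D.ratio' h σ m m') = D.U' h σ m ⊓ D.U' h σ m' := by
  rw [ratio', Y.basicOpen_mul, Y.basicOpen_of_isUnit (Units.isUnit _), basicOpen_rs,
    inf_eq_left.mpr inf_le_left]
  exact D.U'_inf_basicOpen h σ home m m'

/-- The cocycle rule for the `ratio'`: `(σ m'/σ m)(σ m''/σ m') = σ m''/σ m` on
`Y_{σ m} ∩ Y_{σ m'}`. [folklore] -/
theorem ratio'_mul_ratio' (m m' m'' : M) :
    rs inf_le_left (D.ratio' h σ m m') * rs inf_le_right (D.ratio' h σ m' m'') =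
      rs (inf_le_left : D.U' h σ m ⊓ D.U' h σ m' ≤ D.U' h σ m) (D.ratio' h σ m m'') := by
  -- notation: everything restricted to `W = Y_{σ m} ∩ Y_{σ m'} ⊆ U (h m) ∩ U (h m')`
  set W : Y.Opens := D.U' h σ m ⊓ D.U' h σ m' with hW
  have hWm : W ≤ D.U (h m) := inf_le_left.trans (D.U'_le h σ m)
  have hWm' : W ≤ D.U (h m') := inf_le_right.trans (D.U'_le h σ m')
  have hWV : W ≤ D.V (h m) (h m') := by
    rw [D.V_eq]; exact le_inf hWm hWm'
  -- the units `x = σ m / s_{hm}^e`, `y = σ m' / s_{hm'}^e` on `W` and their inverses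
  set x := rs hWm (D.num h σ m) with hx
  set xi := rs (inf_le_left : W ≤ D.U' h σ m) ↑(D.isUnit_num h σ m).unit⁻¹ with hxi
  set y := rs hWm' (D.num h σ m') with hy
  set yi := rs (inf_le_right : W ≤ D.U' h σ m') ↑(D.isUnit_num h σ m').unit⁻¹ with hyi
  have hxxi : x * xi = 1 := by
    have := congrArg (rs (inf_le_left : W ≤ D.U' h σ m)) (D.isUnit_num h σ m).mul_val_inv
    simpa only [map_mul, map_one, rs_rs] using this
  have hyyi : y * yi = 1 := by
    have := congrArg (rs (inf_le_right : W ≤ D.U' h σ m')) (D.isUnit_num h σ m').mul_val_inv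
    simpa only [map_mul, map_one, rs_rs] using this
  -- the transition factor `r = (s_{hm}/s_{hm'})^e` on `W`
  set r := rs (hWV.trans (D.V_le_right (h m) (h m'))) (D.ratio (h m') (h m)) ^ e with hr
  have hB : rs hWm' ((σ m'').val (h m')) = rs hWm ((σ m'').val (h m)) * r := by
    have := congrArg (rs hWV) ((σ m'').compat (h m) (h m'))
    simpa only [map_mul, map_pow, rs_rs] using this
  have hyA : y = rs hWm ((σ m').val (h m)) * r := by
    have := congrArg (rs hWV) ((σ m').compat (h m) (h m'))
    simpa only [map_mul, map_pow, rs_rs] using this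
  -- expand the three ratios on `W`
  have e1 : rs (inf_le_left : W ≤ D.U' h σ m) (D.ratio' h σ m m') =
      rs hWm ((σ m').val (h m)) * xi := by
    simp only [ratio', map_mul, rs_rs]
    rfl
  have e2 : rs (inf_le_right : W ≤ D.U' h σ m') (D.ratio' h σ m' m'') =
      rs hWm' ((σ m'').val (h m')) * yi := by
    simp only [ratio', map_mul, rs_rs]
    rfl
  have e3 : rs (inf_le_left : W ≤ D.U' h σ m) (D.ratio' h σ m m'') =
      rs hWm ((σ m'').val (h m)) * xi := by
    simp only [ratio', map_mul, rs_rs]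
    rfl
  rw [e1, e2, e3, hB]
  set A := rs hWm ((σ m').val (h m))
  set C := rs hWm ((σ m'').val (h m))
  linear_combination (-(C * xi * yi)) * hyA + (C * xi) * hyyi

include home cov in
/-- **Generating-sections data defined by sections of `𝓛^{⊗e}`**: for a family of sections
`σ m ∈ Γ(Y, 𝓛^{⊗e})` with no common zero (`cov`), each supported in a "home chart" `U (h m)`
(`home`), the opens `Y_{σ m}` and the ratios `σ m'/σ m` form generating-sections data — that of
the invertible sheaf `𝓛^{⊗e}` with the generating sections `σ m` (Hartshorne II Thm. 7.1 (b)
applied to `𝓛^{⊗e}`; Görtz–Wedhorn I, Remark 13.46 (1), (3)). [folklore] -/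
def ofSections : GeneratingSections M Y where
  U := D.U' h σ
  iSup_U := cov
  ratio := D.ratio' h σ
  ratio_self := D.ratio'_self h σ
  basicOpen_ratio := D.basicOpen_ratio' h σ home
  ratio_mul_ratio := D.ratio'_mul_ratio' h σ

/-- The opens of `ofSections` are the `Y_{σ m}`. [folklore] -/
@[simp] theorem ofSections_U (m : M) : (D.ofSections h σ home cov).U m = D.U' h σ m := rfl

/-- The ratios of `ofSections`. [folklore] -/
@[simp] theorem ofSections_ratio (m m' : M) :
    (D.ofSections h σ home cov).ratio m m' = D.ratio' h σ m m' := rfl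

end OfSections

end GeneratingSections

end Literature.AlgebraicGeometry.Motives


namespace Literature.AlgebraicGeometry.Motives

namespace GeneratingSections

variable {ι : Type} {Y : Scheme.{u}} (D : GeneratingSections ι Y)

/-! ### Closed immersions: enough to check over an open part of the target covering the image -/

section ClosedImmersionCriterion

omit D in
/-- A morphism `φ : T → P` with closed image which is a closed immersion over each member of a
family of opens `V_a ⊆ P` whose preimages cover `T` is a closed immersion: `φ` factors through
the open `W = ⋃ V_a` as a closed immersion (closed immersions are Zariski-local on the target),
so `φ` is an immersion with closed image, i.e. a closed immersion (Mathlib: a preimmersion with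
closed range is a closed immersion, `IsClosedImmersion.of_isPreimmersion`). [folklore] -/
theorem isClosedImmersion_of_restrict {T P : Scheme.{u}} (φ : T ⟶ P) {κ : Type*}
    (Vs : κ → P.Opens) (hcov : ⨆ a, φ ⁻¹ᵁ Vs a = ⊤)
    (hV : ∀ a, IsClosedImmersion (φ ∣_ Vs a)) (hcl : IsClosed (Set.range φ)) :
    IsClosedImmersion φ := by
  set W : P.Opens := ⨆ a, Vs a with hW
  have hrange : Set.range φ ⊆ Set.range W.ι := by
    rw [Scheme.Opens.range_ι]
    rintro _ ⟨x, rfl⟩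
    have hx : x ∈ (⊤ : T.Opens) := trivial
    rw [← hcov, Opens.mem_iSup] at hx
    obtain ⟨a, ha⟩ := hx
    exact Opens.mem_iSup.mpr ⟨a, ha⟩
  set φ' := IsOpenImmersion.lift W.ι φ hrange with hφ'
  have hfac : φ' ≫ W.ι = φ := IsOpenImmersion.lift_fac _ _ _
  have hφ'cl : IsClosedImmersion φ' := by
    refine IsZariskiLocalAtTarget.of_iSup_eq_top (fun a ↦ W.ι ⁻¹ᵁ Vs a) ?_ fun a ↦ ?_
    · rw [← Scheme.Hom.preimage_iSup, ← hW, Scheme.Opens.ι_preimage_self]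
    · have h : IsClosedImmersion ((φ' ≫ W.ι) ∣_ Vs a) := by
        rw [hfac]
        exact hV a
      rw [morphismRestrict_comp] at h
      have h' : IsClosedImmersion (φ' ∣_ (W.ι ⁻¹ᵁ Vs a) ≫ W.ι ∣_ Vs a) := h
      exact IsClosedImmersion.of_comp (φ' ∣_ (W.ι ⁻¹ᵁ Vs a)) (W.ι ∣_ Vs a)
  rw [← hfac] at hcl ⊢
  exact IsClosedImmersion.of_isPreimmersion _ hcl

end ClosedImmersionCriterion

/-! ### The projective embedding defined by generating sections with affine non-vanishing loci -/

section Embedding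

variable {k : Type u} [Field k] (f : Y ⟶ Spec (.of k)) [LocallyOfFiniteType f]
  (hU : ∀ i, IsAffineOpen (D.U i))

omit [LocallyOfFiniteType f] in
/-- The constants `k → Γ(Y, U i)` have the same range as the ring map `Γ(Spec k, 𝒪) → Γ(Y, U i)`
induced by the structure morphism. [folklore] -/
theorem range_cstr (i : ι) :
    Set.range (D.cstr f i) = Set.range (f.appLE ⊤ (D.U i) le_top).hom := by
  have key : ∀ c : k, D.cstr f i c =
      (f.appLE ⊤ (D.U i) le_top).hom ((Scheme.ΓSpecIso (.of k)).inv c) := by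
    intro c
    change (Y.presheaf.map _).hom (pull f c) = (f.app ⊤ ≫ Y.presheaf.map _).hom _
    rw [pull_apply]
    rfl
  have hc : (D.cstr f i : k → Γ(Y, D.U i)) =
      (f.appLE ⊤ (D.U i) le_top).hom ∘ (Scheme.ΓSpecIso (.of k)).inv.hom := funext key
  have hsurj : Function.Surjective (Scheme.ΓSpecIso (.of k)).inv.hom :=
    (ConcreteCategory.bijective_of_isIso (Scheme.ΓSpecIso (.of k)).inv).2
  rw [hc, hsurj.range_comp]

include hU in
/-- Since `Y` is locally of finite type over `k` and `U i` is affine, `Γ(Y, U i)` is generated as a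
`k`-algebra by a finite set `G`: `Γ(Y, U i)` is the subring generated by `k` and `G`
(Mathlib `LocallyOfFiniteType.finiteType_appLE`). [folklore] -/
theorem exists_finset_closure_eq_top (i : ι) :
    ∃ G : Finset Γ(Y, D.U i), Subring.closure (Set.range (D.cstr f i) ∪ ↑G) = ⊤ := by
  have hft : (f.appLE ⊤ (D.U i) le_top).hom.FiniteType :=
    f.finiteType_appLE (isAffineOpen_top (Spec (.of k))) (hU i) le_top
  letI := (f.appLE ⊤ (D.U i) le_top).hom.toAlgebra
  obtain ⟨G, hG⟩ := (id hft : Algebra.FiniteType _ _).out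
  refine ⟨G, ?_⟩
  rw [range_cstr, ← RingHom.algebraMap_toAlgebra (f.appLE ⊤ (D.U i) le_top).hom,
    ← Algebra.adjoin_eq_ring_closure, hG]
  rfl

/-- A finite set of `k`-algebra generators of `Γ(Y, U i)` (choice). [folklore] -/
def gens (i : ι) : Finset Γ(Y, D.U i) := (D.exists_finset_closure_eq_top f hU i).choose

/-- `Γ(Y, U i)` is the subring generated by `k` and `gens i`. [folklore] -/
theorem closure_gens (i : ι) :
    Subring.closure (Set.range (D.cstr f i) ∪ ↑(D.gens f hU i)) = ⊤ :=
  (D.exists_finset_closure_eq_top f hU i).choose_spec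

/-- The number of chosen generators of `Γ(Y, U i)`. [folklore] -/
def ngens (i : ι) : ℕ := (D.gens f hU i).card

/-- The `l`-th chosen generator of `Γ(Y, U i)` (an enumeration of `gens i` by `Fin`, so that the
index type of the embedding lives in `Type`). [folklore] -/
def gen (i : ι) (l : Fin (D.ngens f hU i)) : Γ(Y, D.U i) := ((D.gens f hU i).equivFin.symm l).1

/-- The enumerated generators are exactly `gens i`. [folklore] -/
theorem range_gen (i : ι) : Set.range (D.gen f hU i) = ↑(D.gens f hU i) := by
  ext s
  constructor
  · rintro ⟨l, rfl⟩
    exact ((D.gens f hU i).equivFin.symm l).2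
  · intro hs
    exact ⟨(D.gens f hU i).equivFin ⟨s, hs⟩, by simp [gen]⟩

/-- `Γ(Y, U i)` is the subring generated by `k` and the enumerated generators. [folklore] -/
theorem closure_gen (i : ι) :
    Subring.closure (Set.range (D.cstr f i) ∪ Set.range (D.gen f hU i)) = ⊤ := by
  rw [range_gen]
  exact D.closure_gens f hU i

variable [Fintype ι]

/-- The degree of an extension of the generator `gen i l` to a section of a power of `𝓛`
(choice, from the extension lemma). [folklore] -/
def extDeg (i : ι) (l : Fin (D.ngens f hU i)) : ℕ :=
  (D.exists_sec_val_eq hU i (D.gen f hU i l)).choose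

/-- An extension of the generator `gen i l ∈ Γ(Y, U i)` to a section of `𝓛^{⊗ extDeg}` (choice).
[folklore] -/
def extSec (i : ι) (l : Fin (D.ngens f hU i)) : D.Sec (D.extDeg f hU i l) :=
  (D.exists_sec_val_eq hU i (D.gen f hU i l)).choose_spec.choose

/-- The extension restricts to the generator on `U i`. [folklore] -/
theorem extSec_val (i : ι) (l : Fin (D.ngens f hU i)) :
    (D.extSec f hU i l).val i = D.gen f hU i l :=
  (D.exists_sec_val_eq hU i (D.gen f hU i l)).choose_spec.choose_spec

/-- A common degree `N ≥ 1` bounding all the `extDeg i l`. [folklore] -/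
def deg : ℕ :=
  (Finset.univ : Finset (Σ i, Fin (D.ngens f hU i))).sup (fun p ↦ D.extDeg f hU p.1 p.2) + 1

/-- `extDeg i l ≤ N`. [folklore] -/
theorem extDeg_le_deg (i : ι) (l : Fin (D.ngens f hU i)) : D.extDeg f hU i l ≤ D.deg f hU :=
  Nat.le_succ_of_le (Finset.le_sup (f := fun p : Σ i, Fin (D.ngens f hU i) ↦ D.extDeg f hU p.1 p.2)
    (Finset.mem_univ (⟨i, l⟩ : Σ i, Fin (D.ngens f hU i))))

/-- `0 < N`. [folklore] -/
theorem deg_pos : 0 < D.deg f hU := Nat.succ_pos _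

/-- The generator `gen i l` as the `U i`-value of a section of `𝓛^{⊗N}`: the extension
`extSec i l` multiplied by `s_i^{⊗(N - extDeg)}`. [folklore] -/
def genSec (i : ι) (l : Fin (D.ngens f hU i)) : D.Sec (D.deg f hU) :=
  ((D.extSec f hU i l).mul (Sec.pow D i (D.deg f hU - D.extDeg f hU i l))).cast
    (Nat.add_sub_cancel' (D.extDeg_le_deg f hU i l))

/-- `genSec i l` has value `gen i l` on `U i`. [folklore] -/
theorem genSec_val (i : ι) (l : Fin (D.ngens f hU i)) :
    (D.genSec f hU i l).val i = D.gen f hU i l := by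
  simp only [genSec, Sec.cast_val, Sec.mul_val, Sec.pow_val, D.ratio_self, one_pow, mul_one,
    extSec_val]

/-- The index set of the new embedding: pairs `(i, none)` (the section `s_i^{⊗2N}`) and
`(i, some l)`, `l < ngens i` (the section `genSec i l ⊗ s_i^{⊗N}`). It lives in `Type`, as the
index types of `Literature.AlgebraicGeometry.Motives.Segre.grading` must. [folklore] -/
abbrev Index : Type := Σ i : ι, Option (Fin (D.ngens f hU i))

/-- The degree-`N` part `τ m` of the new sections: `s_i^{⊗N}` for `m = (i, none)` and the padded
extension of `gen i l` for `m = (i, some l)`. [folklore] -/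
def τ : D.Index f hU → D.Sec (D.deg f hU)
  | ⟨i, none⟩ => Sec.pow D i (D.deg f hU)
  | ⟨i, some l⟩ => D.genSec f hU i l

/-- The new sections `σ m = τ m ⊗ s_{i}^{⊗N}` of `𝓛^{⊗2N}`, `i` the home chart of `m`.
[folklore] -/
def newSec (m : D.Index f hU) : D.Sec (D.deg f hU + D.deg f hU) :=
  (D.τ f hU m).mul (Sec.pow D m.1 (D.deg f hU))

/-- On the home chart, `τ (i, none)` has value `1`. [folklore] -/
theorem τ_val_none (i : ι) : (D.τ f hU ⟨i, none⟩).val i = 1 := by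
  simp only [τ, Sec.pow_val, D.ratio_self, one_pow]

/-- On the home chart, `τ (i, some l)` has value `gen i l`. [folklore] -/
theorem τ_val_some (i : ι) (l : Fin (D.ngens f hU i)) :
    (D.τ f hU ⟨i, some l⟩).val i = D.gen f hU i l := by
  simp only [τ, genSec_val]

/-- The home-chart value of `σ m` is that of `τ m` (times `(s_i/s_i)^N = 1`). [folklore] -/
theorem newSec_val_home (m : D.Index f hU) : (D.newSec f hU m).val m.1 = (D.τ f hU m).val m.1 := by
  simp only [newSec, Sec.mul_val, Sec.pow_val, D.ratio_self, one_pow, mul_one]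

/-- Each new section is supported in its home chart: `Y_{σ m} ⊆ U i` for `m = (i, _)` (thanks
to the factor `s_i^{⊗N}`, `N ≥ 1`). [folklore] -/
theorem newSec_home (m : D.Index f hU) (j : ι) :
    Y.basicOpen ((D.newSec f hU m).val j) ≤ D.U m.1 := by
  rw [newSec, Sec.mul_val, Sec.pow_val, Y.basicOpen_mul, Y.basicOpen_pow _ (D.deg_pos f hU)]
  exact inf_le_right.trans (D.V_le_right j m.1)

/-- The non-vanishing locus of `σ (i, none) = s_i^{⊗2N}` is `U i`. [folklore] -/
theorem basicOpen_newSec_none (i : ι) :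
    Y.basicOpen ((D.newSec f hU ⟨i, none⟩).val i) = D.U i := by
  rw [newSec_val_home, τ_val_none, Y.basicOpen_one]

/-- The new sections have no common zero (already the `s_i^{⊗2N}` do not). [folklore] -/
theorem iSup_basicOpen_newSec :
    ⨆ m : D.Index f hU, Y.basicOpen ((D.newSec f hU m).val m.1) = ⊤ := by
  rw [← top_le_iff, ← D.iSup_U, iSup_le_iff]
  intro i
  rw [← D.basicOpen_newSec_none f hU i]
  exact le_iSup (fun m : D.Index f hU ↦ Y.basicOpen ((D.newSec f hU m).val m.1)) ⟨i, none⟩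

/-- **The generating sections of `𝓛^{⊗2N}` used for the projective embedding**: the sections
`s_i^{⊗2N}` and `(g ⊗ s_i^{⊗(N-d)} extended) ⊗ s_i^{⊗N}`, `g` running through `k`-algebra
generators of the `Γ(Y, U i)` (Görtz–Wedhorn I, proof of Thm. 13.59 / Hartshorne II, proof of
Thm. 7.6, in chart form). [folklore] -/
def embData : GeneratingSections (D.Index f hU) Y :=
  D.ofSections Sigma.fst (D.newSec f hU) (D.newSec_home f hU) (D.iSup_basicOpen_newSec f hU)

/-- The opens of the embedding data are the `Y_{σ m}`, basic opens of the home charts. [folklore] -/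
theorem embData_U (m : D.Index f hU) :
    (D.embData f hU).U m = Y.basicOpen ((D.newSec f hU m).val m.1) := rfl

/-- All the opens `Y_{σ m}` of the embedding data are affine (basic opens of the affine `U i`).
[folklore] -/
theorem isAffineOpen_embData_U (m : D.Index f hU) : IsAffineOpen ((D.embData f hU).U m) :=
  (hU m.1).basicOpen _

/-- The open of the embedding data at `(i, none)` is `U i`. [folklore] -/
theorem embData_U_none (i : ι) : (D.embData f hU).U ⟨i, none⟩ = D.U i :=
  D.basicOpen_newSec_none f hU i

/-- At the chart `(i, none)` the ratio towards `(i, some l)` is the generator `gen i l` itself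
(restricted along `Y_{s_i^{2N}} = U i`): `σ_{(i,l)} / s_i^{2N} = gen i l` on `U i`. [folklore] -/
theorem embData_ratio_none_some (i : ι) (l : Fin (D.ngens f hU i)) :
    (D.embData f hU).ratio ⟨i, none⟩ ⟨i, some l⟩ =
      rs (le_of_eq (D.embData_U_none f hU i)) (D.gen f hU i l) := by
  have h := D.ratio'_mul_num Sigma.fst (D.newSec f hU) ⟨i, none⟩ ⟨i, some l⟩
  rw [num, newSec_val_home, τ_val_none, map_one, mul_one, newSec_val_home, τ_val_some] at h
  exact h

/-- At the chart `(i, none)` the constants of the embedding data are those of `U i` restricted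
along `Y_{s_i^{2N}} = U i`. [folklore] -/
theorem embData_cstr_none (i : ι) (c : k) :
    (D.embData f hU).cstr f ⟨i, none⟩ c = rs (le_of_eq (D.embData_U_none f hU i)) (D.cstr f i c) := by
  simp only [cstr, RingHom.comp_apply, rs_rs]

/-- **Surjectivity at the charts `(i, none)`.** `Γ(Y, Y_{s_i^{2N}}) = Γ(Y, U i)` is generated by
`k` and the ratios `σ_{(i,l)}/s_i^{2N} = gen i l` (Hartshorne II Prop. 7.2, hypothesis (2), for
these charts). [folklore] -/
theorem closure_embData_none (m : D.Index f hU) (hm : m.2 = none) :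
    Subring.closure (Set.range ((D.embData f hU).cstr f m) ∪
      Set.range ((D.embData f hU).ratio m)) = ⊤ := by
  obtain ⟨i, o⟩ := m
  cases o with
  | some _ => exact absurd hm (by simp)
  | none =>
    set θ : Γ(Y, D.U i) →+* Γ(Y, (D.embData f hU).U ⟨i, none⟩) :=
      rs (le_of_eq (D.embData_U_none f hU i)) with hθ
    have hθsurj : Function.Surjective θ := by
      intro s
      refine ⟨rs (le_of_eq (D.embData_U_none f hU i).symm) s, ?_⟩
      rw [hθ, rs_rs, rs_refl]
    -- the generating set of `Γ(Y, U i)` maps into the target generating set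
    have hsub : θ '' (Set.range (D.cstr f i) ∪ Set.range (D.gen f hU i)) ⊆
        Set.range ((D.embData f hU).cstr f ⟨i, none⟩) ∪
          Set.range ((D.embData f hU).ratio ⟨i, none⟩) := by
      rintro _ ⟨s, hs | hs, rfl⟩
      · obtain ⟨c, rfl⟩ := hs
        exact Or.inl ⟨c, D.embData_cstr_none f hU i c⟩
      · obtain ⟨l, rfl⟩ := hs
        exact Or.inr ⟨⟨i, some l⟩, D.embData_ratio_none_some f hU i l⟩
    rw [← top_le_iff]
    calc (⊤ : Subring _) = θ.range := (RingHom.range_eq_top.mpr hθsurj).symm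
      _ = (Subring.closure (Set.range (D.cstr f i) ∪ Set.range (D.gen f hU i))).map θ := by
          rw [D.closure_gen f hU i, ← RingHom.range_eq_map]
      _ = Subring.closure (θ '' (Set.range (D.cstr f i) ∪ Set.range (D.gen f hU i))) :=
          RingHom.map_closure _ _
      _ ≤ _ := Subring.closure_mono hsub

/-- After reindexing the embedding data by `Fin (n + 1)`, the preimages of the charts `D₊(x_a)`
with `a ↔ (i, none)` are the `U i`, so they cover `Y`. [folklore] -/
theorem iSup_preimage_chart_none {n : ℕ} (e : Fin (n + 1) ≃ D.Index f hU) :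
    ⨆ a : {a : Fin (n + 1) // ∃ i, e a = ⟨i, none⟩},
      ((D.embData f hU).reindex e).toProj f ⁻¹ᵁ Proj.basicOpen (grading (Fin (n + 1)) k) (X a.1) =
        ⊤ := by
  rw [← top_le_iff, ← D.iSup_U, iSup_le_iff]
  intro i
  let a : {a : Fin (n + 1) // ∃ i, e a = ⟨i, none⟩} := ⟨e.symm ⟨i, none⟩, i, e.apply_symm_apply _⟩
  refine le_trans (le_of_eq ?_) (le_iSup (fun a : {a : Fin (n + 1) // ∃ i, e a = ⟨i, none⟩} ↦
    ((D.embData f hU).reindex e).toProj f ⁻¹ᵁ Proj.basicOpen (grading (Fin (n + 1)) k) (X a.1)) a)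
  rw [toProj_preimage_basicOpen, reindex_U, Equiv.apply_symm_apply, embData_U_none]

/-- Over a chart `D₊(x_a)` with `a ↔ (i, none)`, the morphism to `ℙⁿ` defined by the (reindexed)
embedding data is a closed immersion: `U i` is affine and the chart ring map is surjective
(Hartshorne II Prop. 7.2 for these charts). [folklore] -/
theorem isClosedImmersion_restrict_chart_none {n : ℕ} (e : Fin (n + 1) ≃ D.Index f hU)
    (a : Fin (n + 1)) (ha : ∃ i, e a = ⟨i, none⟩) :
    IsClosedImmersion (((D.embData f hU).reindex e).toProj f ∣_
      Proj.basicOpen (grading (Fin (n + 1)) k) (X a)) := by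
  refine ((D.embData f hU).reindex e).isClosedImmersion_toProj_restrict f a
    (D.isAffineOpen_embData_U f hU (e a))
    (((D.embData f hU).reindex e).sectionsRingHom_surjective_of_closure_eq_top f a ?_)
  have hr : Set.range (((D.embData f hU).reindex e).ratio a) =
      Set.range ((D.embData f hU).ratio (e a)) := by
    change Set.range (fun b ↦ (D.embData f hU).ratio (e a) (e b)) = _
    exact e.surjective.range_comp ((D.embData f hU).ratio (e a))
  have hm : (e a).2 = none := by
    obtain ⟨i, hi⟩ := ha
    rw [hi]
  rw [hr]
  exact D.closure_embData_none f hU (e a) hm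

end Embedding

/-! ### Projectivity -/

section Projective

variable {k : Type u} [Field k] {Z : SchemeOver k} [Finite ι] (D : GeneratingSections ι Z.left)
  (hU : ∀ i, IsAffineOpen (D.U i))

omit D in
/-- The empty `k`-scheme is projective. [folklore] -/
theorem _root_.Literature.AlgebraicGeometry.Motives.isProjectiveOver_of_isEmpty [IsEmpty Z.left] : IsProjectiveOver Z :=
  ⟨0, Over.homMk (isInitialOfIsEmpty.to _) (isInitialOfIsEmpty.hom_ext _ _), inferInstance⟩

include hU in
/-- **A proper `k`-scheme carrying generating-sections data with finitely many, affine,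
non-vanishing loci `U i = Z_{sᵢ}` is projective over `k`.** In terms of the invertible sheaf `𝓛`
glued from the data: `𝓛` is generated by finitely many global sections `sᵢ` with `Z_{sᵢ}`
affine, hence ample (Görtz–Wedhorn I, Prop. 13.47 (iv) ⇒ (i)); equivalently the morphism
`Z → ℙ(ι)` it defines is affine, so `𝓛` is ample by Görtz–Wedhorn I, Thm. 13.84; and a proper
`k`-scheme with an ample line bundle is projective (Görtz–Wedhorn I, Cor. 13.72 with
Summary 13.71 (3)). The proof is the printed one in chart form: `k`-algebra generators of the
`Γ(Z, U i)` extend, after multiplication by `s_i^{⊗d}`, to global sections of `𝓛^{⊗d}`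
(`exists_sec_val_eq`, Görtz–Wedhorn I Thm. 7.22), and together with the `s_i^{⊗2N}` these
sections of `𝓛^{⊗2N}` define a morphism `Z → ℙᴹ_k` (Hartshorne II Thm. 7.1) which is a closed
immersion over the charts `D₊(x_{(i, none)})` (Hartshorne II Prop. 7.2) covering the image; the
image being closed (`Z` is proper), it is a closed immersion.
[cite: GortzWedhorn2020, Thm. 13.84 and Cor. 13.72 with Summary 13.71 (3); Prop. 13.47] -/
theorem isProjectiveOver_of_isAffineOpen [IsProper Z.hom] : IsProjectiveOver Z := by
  classical
  cases isEmpty_or_nonempty ι with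
  | inl hι =>
    -- no charts: `Z` is empty
    haveI : IsEmpty Z.left := ⟨fun z ↦ by
      have hz : z ∈ (⊤ : Z.left.Opens) := trivial
      rw [← D.iSup_U, Opens.mem_iSup] at hz
      obtain ⟨i, -⟩ := hz
      exact hι.elim i⟩
    exact isProjectiveOver_of_isEmpty
  | inr hι =>
    haveI := Fintype.ofFinite ι
    obtain ⟨i₀⟩ := hι
    -- reindex the embedding data by `Fin (n + 1)`
    have hcard : Fintype.card (D.Index Z.hom hU) =
        (Fintype.card (D.Index Z.hom hU) - 1) + 1 :=
      (Nat.sub_add_cancel (Fintype.card_pos_iff.mpr ⟨⟨i₀, none⟩⟩)).symm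
    set n := Fintype.card (D.Index Z.hom hU) - 1 with hn
    set e : Fin (n + 1) ≃ D.Index Z.hom hU := (Fintype.equivFinOfCardEq hcard).symm with he
    refine ⟨n, ((D.embData Z.hom hU).reindex e).toProjectiveSpace, ?_⟩
    rw [toProjectiveSpace_left]
    -- closed immersion over the charts `D₊(x_a)`, `e a = (i, none)`, which cover the image
    refine isClosedImmersion_of_restrict (((D.embData Z.hom hU).reindex e).toProj Z.hom)
      (κ := {a : Fin (n + 1) // ∃ i, e a = ⟨i, none⟩})
      (fun a ↦ Proj.basicOpen (grading (Fin (n + 1)) k) (X a.1))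
      (D.iSup_preimage_chart_none Z.hom hU e)
      (fun a ↦ D.isClosedImmersion_restrict_chart_none Z.hom hU e a.1 a.2) ?_
    -- the image is closed: `Z → ℙ` is universally closed as `Z` is proper and `ℙ → Spec k`
    -- separated
    have h1 : UniversallyClosed (((D.embData Z.hom hU).reindex e).toProj Z.hom ≫
        toSpec (Fin (n + 1)) k) := by
      rw [toProj_toSpec]
      infer_instance
    have h2 : IsSeparated (toSpec (Fin (n + 1)) k) := by
      unfold toSpec
      infer_instance
    have h3 : UniversallyClosed (((D.embData Z.hom hU).reindex e).toProj Z.hom) :=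
      .of_comp_of_isSeparated _ (toSpec (Fin (n + 1)) k)
    exact (((D.embData Z.hom hU).reindex e).toProj Z.hom).isClosedMap.isClosed_range

end Projective

end GeneratingSections

end Literature.AlgebraicGeometry.Motives

namespace Literature.AlgebraicGeometry.Motives

namespace GeneratingSections

/-! ### Generating-sections data from a morphism to `ℙ(ι)` (Hartshorne II Thm. 7.1 (a)) -/

section OfHom

variable {ι : Type} {k : Type u} [CommRing k] {Y : Scheme.{u}} (r : Y ⟶ Proj (grading ι k))

/-- The preimage `r⁻¹ D₊(xᵢ)` of the `i`-th standard chart. [folklore] -/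
abbrev preU (i : ι) : Y.Opens := r ⁻¹ᵁ Proj.basicOpen (grading ι k) (X i)

/-- On `r⁻¹ D₊(xᵢ)`, `r` factors through the chart `Spec (k[x]_{(xᵢ)})₀ = D₊(xᵢ)`. [folklore] -/
def chartLift (i : ι) : (preU r i : Scheme.{u}) ⟶ Spec (.of (Away (grading ι k) (X i))) :=
  IsOpenImmersion.lift (chartι k i) ((preU r i).ι ≫ r) (by
    have h : Set.range (chartι k i) = (Proj.basicOpen (grading ι k) (X i) : Set _) := by
      rw [← Scheme.Hom.coe_opensRange, Proj.opensRange_awayι]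
    rw [h]
    rintro _ ⟨y, rfl⟩
    exact y.2)

/-- The factorisation property of `chartLift`. [folklore] -/
@[reassoc]
theorem chartLift_chartι (i : ι) : chartLift r i ≫ chartι k i = (preU r i).ι ≫ r :=
  IsOpenImmersion.lift_fac _ _ _

/-- The ratio `r^*(x_j/x_i) ∈ Γ(Y, r⁻¹ D₊(xᵢ))` (Hartshorne II Thm. 7.1 (a): `sᵢ = φ^* xᵢ`).
[folklore] -/
def homRatio (i j : ι) : Γ(Y, preU r i) := (preU r i).topIso.hom (pull (chartLift r i) (frac k i j))

omit r in
/-- Restricting a section transported along `U.topIso` is transporting its pullback along the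
inclusion of open subschemes. [folklore] -/
theorem rs_topIso_hom {U W : Y.Opens} (h : W ≤ U) (t : Γ(U, ⊤)) :
    rs h (U.topIso.hom t) = W.topIso.hom ((Y.homOfLE h).appTop t) := by
  rw [Scheme.homOfLE_appTop]
  simp only [Scheme.Opens.topIso_hom]
  change (Y.presheaf.map _ ≫ Y.presheaf.map _).hom t = (Y.presheaf.map _ ≫ Y.presheaf.map _).hom t
  rw [← Functor.map_comp, ← Functor.map_comp]
  congr 3

/-- `r^*(x_i/x_i) = 1`. [folklore] -/
theorem homRatio_self (i : ι) : homRatio r i i = 1 := by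
  rw [homRatio, frac_self, map_one, map_one]

/-- `Y_{r^*(x_j/x_i)} = r⁻¹ D₊(xᵢ) ∩ r⁻¹ D₊(x_j)`. [folklore] -/
theorem basicOpen_homRatio (i j : ι) : Y.basicOpen (homRatio r i j) = preU r i ⊓ preU r j := by
  rw [homRatio]
  have h1 : Y.basicOpen ((preU r i).topIso.hom (pull (chartLift r i) (frac k i j))) =
      (preU r i).ι ''ᵁ (preU r i : Scheme.{u}).basicOpen (pull (chartLift r i) (frac k i j)) := by
    rw [← Scheme.Opens.ι_image_basicOpen_topIso_inv, ← CommRingCat.comp_apply, Iso.hom_inv_id]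
    rfl
  rw [h1, basicOpen_pull, ← Proj.awayι_preimage_basicOpen _ (X_mem k i) zero_lt_one (X_mem k j)
    zero_lt_one, ← Scheme.Hom.comp_preimage, chartLift_chartι, Scheme.Hom.comp_preimage,
    Scheme.Hom.image_preimage_eq_opensRange_inf, Scheme.Opens.opensRange_ι]

/-- The cocycle rule `r^*(x_j/x_i) · r^*(x_l/x_j) = r^*(x_l/x_i)` on `r⁻¹ D₊(xᵢ) ∩ r⁻¹ D₊(x_j)`,
pulled back from the identity `x_l/x_i = (x_l/x_j)(x_j/x_i)` in `(k[x]_{(xᵢx_j)})₀`. [folklore] -/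
theorem homRatio_mul_homRatio (i j l : ι) :
    Y.presheaf.map (homOfLE inf_le_left).op (homRatio r i j) *
        Y.presheaf.map (homOfLE inf_le_right).op (homRatio r j l) =
      Y.presheaf.map (homOfLE (inf_le_left : preU r i ⊓ preU r j ≤ preU r i)).op
        (homRatio r i l) := by
  set W : Y.Opens := preU r i ⊓ preU r j with hW
  -- the two chart maps on `W` and their common refinement through `D₊(xᵢ x_j)`
  set αi := Y.homOfLE (inf_le_left : W ≤ preU r i) ≫ chartLift r i with hαi
  set αj := Y.homOfLE (inf_le_right : W ≤ preU r j) ≫ chartLift r j with hαj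
  have hα : αi ≫ chartι k i = αj ≫ chartι k j := by
    rw [hαi, hαj, Category.assoc, Category.assoc, chartLift_chartι, chartLift_chartι,
      Scheme.homOfLE_ι_assoc, Scheme.homOfLE_ι_assoc]
  obtain ⟨γ, hγi, hγj⟩ := exists_lift_of_comp_chartι_eq αi αj hα
  -- the identity in `Γ(W, ⊤)`
  have key : pull αi (frac k i j) * pull αj (frac k j l) = pull αi (frac k i l) := by
    rw [← hγi, ← hγj]
    simp only [pull_SpecMap', RingHom.comp_apply, CommRingCat.hom_ofHom]
    rw [awayMap_frac k i j l, map_mul, mul_comm]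
  -- transport to `Γ(Y, W)`
  have e1 : Y.presheaf.map (homOfLE (inf_le_left : W ≤ preU r i)).op (homRatio r i j) =
      W.topIso.hom (pull αi (frac k i j)) := by
    rw [homRatio, hαi, pull_comp]; exact rs_topIso_hom _ _
  have e2 : Y.presheaf.map (homOfLE (inf_le_right : W ≤ preU r j)).op (homRatio r j l) =
      W.topIso.hom (pull αj (frac k j l)) := by
    rw [homRatio, hαj, pull_comp]; exact rs_topIso_hom _ _
  have e3 : Y.presheaf.map (homOfLE (inf_le_left : W ≤ preU r i)).op (homRatio r i l) =
      W.topIso.hom (pull αi (frac k i l)) := by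
    rw [homRatio, hαi, pull_comp]; exact rs_topIso_hom _ _
  change Y.presheaf.map (homOfLE (inf_le_left : W ≤ preU r i)).op (homRatio r i j) *
      Y.presheaf.map (homOfLE (inf_le_right : W ≤ preU r j)).op (homRatio r j l) =
    Y.presheaf.map (homOfLE (inf_le_left : W ≤ preU r i)).op (homRatio r i l)
  rw [e1, e2, e3, ← map_mul, key]

/-- The `r⁻¹ D₊(xᵢ)` cover `Y`. [folklore] -/
theorem iSup_preU : ⨆ i, preU r i = ⊤ :=
  r.iSup_preimage_eq_top (Proj.iSup_basicOpen_eq_top (grading ι k)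
    (fun i : ι ↦ (X i : MvPolynomial ι k)) (irrelevant_le_span_X ι k))

/-- **Generating-sections data of a morphism to projective space** (Hartshorne II Thm. 7.1 (a):
"`φ^*(𝒪(1))` is an invertible sheaf on `X`, which is generated by the global sections
`sᵢ = φ^*(xᵢ)`"): the opens `r⁻¹ D₊(xᵢ)` and the ratios `r^*(x_j/x_i)`.
[cite: Hartshorne1977, II Thm. 7.1 (a)] -/
def ofHom : GeneratingSections ι Y where
  U := preU r
  iSup_U := iSup_preU r
  ratio := homRatio r
  ratio_self := homRatio_self r
  basicOpen_ratio := basicOpen_homRatio r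
  ratio_mul_ratio := homRatio_mul_homRatio r

/-- The opens of `ofHom r` are the `r⁻¹ D₊(xᵢ)`. [folklore] -/
@[simp] theorem ofHom_U (i : ι) : (ofHom r).U i = r ⁻¹ᵁ Proj.basicOpen (grading ι k) (X i) := rfl

/-- The ratios of `ofHom r` are the `r^*(x_j/x_i)`. [folklore] -/
@[simp] theorem ofHom_ratio (i j : ι) : (ofHom r).ratio i j = homRatio r i j := rfl

/-- For an affine morphism `r : Y → ℙ(ι)` the opens `r⁻¹ D₊(xᵢ)` are affine. [folklore] -/
theorem isAffineOpen_ofHom_U [IsAffineHom r] (i : ι) : IsAffineOpen ((ofHom r).U i) :=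
  (Proj.isAffineOpen_basicOpen (grading ι k) (X i) (X_mem k i) zero_lt_one).preimage r

end OfHom

end GeneratingSections

/-! ### Proper schemes affine, finite or quasi-finite over `ℙⁿ_k` are projective -/

section AffineOverProjectiveSpace

variable {n : ℕ} {k : Type u} [Field k] {Z : SchemeOver k} [IsProper Z.hom]
  (r : Z ⟶ projectiveSpace n k)

/-- **A proper `k`-scheme with an affine `k`-morphism to `ℙⁿ_k` is projective** (Görtz–Wedhorn I,
Thm. 13.84 (2): for `f : X → S` proper and `r : X → ℙ(𝓔)`, `𝓛 = r^*𝒪(1)` is ample iff `r` is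
finite iff `r` is quasi-affine; with Cor. 13.72: proper with an ample line bundle is projective).
Here: the generating sections `r^* xᵢ` have the affine non-vanishing loci `r⁻¹ D₊(xᵢ)`
(`GeneratingSections.ofHom`), so `GeneratingSections.isProjectiveOver_of_isAffineOpen` applies.
[cite: GortzWedhorn2020, Thm. 13.84 (2) (p. 516) with Cor. 13.72 (p. 512)] -/
theorem isProjectiveOver_of_isAffineHom [h : IsAffineHom r.left] : IsProjectiveOver Z :=
  haveI : @IsAffineHom Z.left (Proj (grading (Fin (n + 1)) k)) r.left := h
  (GeneratingSections.ofHom (k := k) (ι := Fin (n + 1)) r.left).isProjectiveOver_of_isAffineOpen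
    (GeneratingSections.isAffineOpen_ofHom_U (k := k) (ι := Fin (n + 1)) r.left)

/-- A proper `k`-scheme finite over `ℙⁿ_k` is projective (Görtz–Wedhorn I, Thm. 13.84 (2),
(ii) ⇒ (i), with Cor. 13.72). [cite: GortzWedhorn2020, Thm. 13.84 (2) (p. 516) with Cor. 13.72 (p. 512)] -/
theorem isProjectiveOver_of_isFinite [IsFinite r.left] : IsProjectiveOver Z :=
  isProjectiveOver_of_isAffineHom r

/-- A proper `k`-scheme quasi-finite over `ℙⁿ_k` is projective (Görtz–Wedhorn I, Thm. 13.84 (1)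
with Cor. 13.72): `r` is proper (as `Z` is proper and `ℙⁿ_k` separated over `k`) and quasi-finite,
hence finite by Zariski's Main Theorem (Mathlib `IsFinite.of_isProper_of_locallyQuasiFinite`;
Görtz–Wedhorn I, Cor. 12.89). [cite: GortzWedhorn2020, Thm. 13.84 (1) (p. 516) with Cor. 13.72 (p. 512) and Cor. 12.89 (p. 454)] -/
theorem isProjectiveOver_of_locallyQuasiFinite [LocallyQuasiFinite r.left] :
    IsProjectiveOver Z := by
  have h1 : IsProper (r.left ≫ (projectiveSpace n k).hom) := by
    rw [Over.w r]
    infer_instance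
  have h2 : IsSeparated (toSpec (Fin (n + 1)) k) := by
    unfold Segre.toSpec
    infer_instance
  have h2' : IsSeparated (projectiveSpace n k).hom := h2
  have : IsProper r.left := IsProper.of_comp r.left (projectiveSpace n k).hom
  have : IsFinite r.left := IsFinite.of_isProper_of_locallyQuasiFinite r.left
  exact isProjectiveOver_of_isFinite r

end AffineOverProjectiveSpace

end Literature.AlgebraicGeometry.Motives
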